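import Mathlib
import HarnessLib
import Literature.Computability.AlgebraicComplexity.ArithCircuitDegreeBound
import Literature.Computability.AlgebraicComplexity.StandardFamiliesProofs
import Summits.ValiantsHypothesis.ValiantsHypothesis.Theorems.DepthWindowHalf

/-!
# DepthWindow / DefinabilityGap — hygiene: the DIAL-FORM depth rungs for the permanent are decided at `n = 2`
# (support for item `stmt-ValiantsHypothesis-23549`; decomp-valiant workshop, lens 5 generation 13, cross-lens note)

The route `DepthWindow` (lens 4) states its crux `PerHardLog3` and its landed rungs in DIAL FORM
`¬ ∃ c, ∀ n, ∃ C, C.Computes per_n ∧ C.productDepth ≤ β(n) ∧ C.edgeSize ≤ n ^ c + c` (and the registered-stub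
form `∀ c, ∃ n, ∀ C, … → n ^ c + c < C.edgeSize`).  This file records, kernel-checked, a fact about that SHAPE:
whenever the depth budget vanishes at `n = 2` (`β 2 = 0`) the dial-form statement is ALREADY WITNESSED AT `n = 2`
— a product-free circuit (product-depth `0`) computes a polynomial of total degree `≤ 1`
(`ArithCircuit.totalDegree_eval_le_edgeSize_pow` with `Δ = 0`), while `deg per_2 = 2` — so it carries no
asymptotic content, whatever the slope in front of `log₂log₂log₂ n`.  Instances (checked below by `example`s
elaborating the SAME statement both from the trivial witness and from the landed theorem):
`DepthWindow.perHardGrowingDepth` (budget `⌊L₃ n⌋ / 3`), `DepthWindow.perHardBelowHalf p q` (budget `p ⌊L₃ n⌋ / q`,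
landed under `2p < q` but true for EVERY `p q`, e.g. slope `100`), and their `_lst` forms
(`L₃ n := ⌊log₂⌊log₂⌊log₂ n⌋⌋⌋`, `L₃ 2 = 0`).

NOT affected (budget `≥ 1` at `n = 2`, where `per_2 = X₀₀X₁₁ + X₀₁X₁₀` has a `ΣΠ` circuit): the crux `PerHardLog3`
(budget `L₃ n + 1`), the residual `CollapseLog3`, the constant-depth rungs (`perHardConstDepth`, `perHard_io`), and
every statement in ROBUST form `∀ c m₀, ∃ n ≥ m₀, …` / `∀ c, ∃ m₀, ∀ m ≥ m₀, …` — lens 4's `ImmHardAt`,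
`HomImmHardAt`, `TreeBiasGrowthAt`, and the permanent's robust growing-depth rung
`DefinabilityGapK1DepthLadder.perHard_io_log3` (`25 p ≤ 18 q → ∀ K c m₀, ∃ n ≥ m₀`, every product-depth-
`(⌊p L₃ n / q⌋ + K)` circuit for `per_n` has `> n ^ c + c` wires), which is the content-bearing per-rung at every
slope `≤ 18/25` and the form consumers (hitting-set transfers) actually use.  The PROOFS of the landed dial-form
rungs do real work (LST/BDS at a tower); the point is only that their STATEMENTS do not record it, so a rung cited
as a witness (BC5/T3) or in the workshop's rung tables should be cited in robust form.  Honest framing: hygiene;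
no item changes; `VP ≠ VNP` untouched.

References: [LimayeSrinivasanTavenas2025] §2 (product-depth, wires); [AndrewsForbes2022] proof of Lemma 6.7
(`deg ≤ s^Δ`); [Burgisser2000] §2.1 (`deg per_n = n`).
-/

set_option linter.dupNamespace false

noncomputable section

open MvPolynomial
open Literature.Computability.AlgebraicComplexity

namespace Summit.ValiantsHypothesis.ValiantsHypothesis.Theorems.DepthWindowDialAtTwo

/-- **No product-free circuit computes `per_2`**: product-depth `0` forces total degree `≤ (wires + 1) ^ 0 = 1`
(`totalDegree_eval_le_edgeSize_pow`), but `deg per_2 = 2` (`totalDegree_perPoly_holds`).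
[cite: AndrewsForbes2022, Lemma 6.7 (proof)] [cite: Burgisser2000, §2.1] -/
theorem not_computes_perTwo_of_productDepth_eq_zero (C : ArithCircuit ℂ (Fin 2 × Fin 2))
    (hC : C.Computes (perPoly (Fin 2) ℂ)) (hd : C.productDepth = 0) : False := by
  have hdeg : (perPoly (Fin 2) ℂ).totalDegree = 2 := by
    simpa using (totalDegree_perPoly_holds (n := Fin 2) (k := ℂ) :
      (perPoly (Fin 2) ℂ).totalDegree = Fintype.card (Fin 2))
  have h1 : C.eval.totalDegree ≤ (C.edgeSize + 1) ^ 0 :=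
    C.totalDegree_eval_le_edgeSize_pow (s := C.edgeSize + 1) (Δ := 0) (by omega) (by omega) hd.le
  rw [pow_zero, show C.eval = perPoly (Fin 2) ℂ from hC, hdeg] at h1
  omega

/-- **The dial form is decided at `n = 2`**: for ANY depth budget `β : ℕ → ℕ` with `β 2 = 0` — any slope, any
growth — "there is no `c` such that every `per_n` has a circuit of product-depth `≤ β n` with `≤ n ^ c + c` wires"
holds, witnessed by `n = 2` alone. [folklore] -/
theorem perDial_of_budget_two_eq_zero (β : ℕ → ℕ) (hβ : β 2 = 0) :
    ¬ ∃ c : ℕ, ∀ n : ℕ, ∃ C : ArithCircuit ℂ (Fin n × Fin n),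
      C.Computes (perPoly (Fin n) ℂ) ∧ C.productDepth ≤ β n ∧ C.edgeSize ≤ n ^ c + c := by
  rintro ⟨c, hc⟩
  obtain ⟨C, hC, hd, -⟩ := hc 2
  exact not_computes_perTwo_of_productDepth_eq_zero C hC (by rw [hβ] at hd; omega)

/-- **The registered-stub (`∀ c ∃ n`) form is decided at `n = 2`** likewise (vacuously: no admissible `C`). [folklore] -/
theorem perDialLst_of_budget_two_eq_zero (β : ℕ → ℕ) (hβ : β 2 = 0) (c : ℕ) :
    ∃ n : ℕ, ∀ C : ArithCircuit ℂ (Fin n × Fin n), C.Computes (perPoly (Fin n) ℂ) →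
      C.productDepth ≤ β n → n ^ c + c < C.edgeSize :=
  ⟨2, fun C hC hd => (not_computes_perTwo_of_productDepth_eq_zero C hC (by rw [hβ] at hd; omega)).elim⟩

/-- `L₃ 2 = ⌊log₂⌊log₂⌊log₂ 2⌋⌋⌋ = 0`. [folklore] -/
theorem log3_two : Nat.log 2 (Nat.log 2 (Nat.log 2 2)) = 0 := by
  have h2 : Nat.log 2 2 = 1 := by simpa using Nat.log_pow (b := 2) (by norm_num) 1
  rw [h2]
  simp

/-- **Every slope, no hypothesis**: the statement of `DepthWindow.perHardBelowHalf p q` (landed under `2 p < q`)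
holds for ALL `p q : ℕ` — slope `p/q = 100` included — by the witness `n = 2`; so as a STATEMENT it does not
express "`per` is hard at product-depth `(p/q)·log₂log₂log₂ n` for `p/q < 1/2`". [folklore] -/
theorem perDial_all_slopes (p q : ℕ) :
    ¬ ∃ c : ℕ, ∀ n : ℕ, ∃ C : ArithCircuit ℂ (Fin n × Fin n),
      C.Computes (perPoly (Fin n) ℂ) ∧
        C.productDepth ≤ p * Nat.log 2 (Nat.log 2 (Nat.log 2 n)) / q ∧ C.edgeSize ≤ n ^ c + c :=
  perDial_of_budget_two_eq_zero _ (by simp [log3_two])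

/-- … and its `_lst` form for all `p q c`. [folklore] -/
theorem perDialLst_all_slopes (p q c : ℕ) :
    ∃ n : ℕ, ∀ C : ArithCircuit ℂ (Fin n × Fin n), C.Computes (perPoly (Fin n) ℂ) →
      C.productDepth ≤ p * Nat.log 2 (Nat.log 2 (Nat.log 2 n)) / q → n ^ c + c < C.edgeSize :=
  perDialLst_of_budget_two_eq_zero _ (by simp [log3_two]) c

/-! ### Checks: the landed dial-form rungs are instances (same statement, elaborated twice) -/

-- `DepthWindow.perHardGrowingDepth` (lens 4, gen 3): once from the landed theorem, once from `n = 2`.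
example : ¬ ∃ c : ℕ, ∀ n : ℕ, ∃ C : ArithCircuit ℂ (Fin n × Fin n),
    C.Computes (perPoly (Fin n) ℂ) ∧ C.productDepth ≤ Nat.log 2 (Nat.log 2 (Nat.log 2 n)) / 3 ∧
      C.edgeSize ≤ n ^ c + c :=
  DepthWindow.perHardGrowingDepth
example : ¬ ∃ c : ℕ, ∀ n : ℕ, ∃ C : ArithCircuit ℂ (Fin n × Fin n),
    C.Computes (perPoly (Fin n) ℂ) ∧ C.productDepth ≤ Nat.log 2 (Nat.log 2 (Nat.log 2 n)) / 3 ∧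
      C.edgeSize ≤ n ^ c + c :=
  perDial_of_budget_two_eq_zero _ (by simp [log3_two])

-- `DepthWindow.perHardBelowHalf p q (2p < q)` (lens 4, gen 4): the landed theorem, and the hypothesis-free witness.
example (p q : ℕ) (hpq : 2 * p < q) : ¬ ∃ c : ℕ, ∀ n : ℕ, ∃ C : ArithCircuit ℂ (Fin n × Fin n),
    C.Computes (perPoly (Fin n) ℂ) ∧
      C.productDepth ≤ p * Nat.log 2 (Nat.log 2 (Nat.log 2 n)) / q ∧ C.edgeSize ≤ n ^ c + c :=
  DepthWindow.perHardBelowHalf p q hpq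
example (p q : ℕ) : ¬ ∃ c : ℕ, ∀ n : ℕ, ∃ C : ArithCircuit ℂ (Fin n × Fin n),
    C.Computes (perPoly (Fin n) ℂ) ∧
      C.productDepth ≤ p * Nat.log 2 (Nat.log 2 (Nat.log 2 n)) / q ∧ C.edgeSize ≤ n ^ c + c :=
  perDial_all_slopes p q

-- the registered-stub forms `perHardGrowingDepth_lst`, `perHardBelowHalf_lst`.
example : ∀ c : ℕ, ∃ n : ℕ, ∀ C : ArithCircuit ℂ (Fin n × Fin n), C.Computes (perPoly (Fin n) ℂ) →
    C.productDepth ≤ Nat.log 2 (Nat.log 2 (Nat.log 2 n)) / 3 → n ^ c + c < C.edgeSize :=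
  DepthWindow.perHardGrowingDepth_lst
example : ∀ c : ℕ, ∃ n : ℕ, ∀ C : ArithCircuit ℂ (Fin n × Fin n), C.Computes (perPoly (Fin n) ℂ) →
    C.productDepth ≤ Nat.log 2 (Nat.log 2 (Nat.log 2 n)) / 3 → n ^ c + c < C.edgeSize :=
  fun c => perDialLst_of_budget_two_eq_zero _ (by simp [log3_two]) c
example : ∀ p q c : ℕ, 2 * p < q → ∃ n : ℕ, ∀ C : ArithCircuit ℂ (Fin n × Fin n),
    C.Computes (perPoly (Fin n) ℂ) → C.productDepth ≤ p * Nat.log 2 (Nat.log 2 (Nat.log 2 n)) / q →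
      n ^ c + c < C.edgeSize :=
  DepthWindow.perHardBelowHalf_lst
example : ∀ p q c : ℕ, 2 * p < q → ∃ n : ℕ, ∀ C : ArithCircuit ℂ (Fin n × Fin n),
    C.Computes (perPoly (Fin n) ℂ) → C.productDepth ≤ p * Nat.log 2 (Nat.log 2 (Nat.log 2 n)) / q →
      n ^ c + c < C.edgeSize :=
  fun p q c _ => perDialLst_all_slopes p q c

end Summit.ValiantsHypothesis.ValiantsHypothesis.Theorems.DepthWindowDialAtTwo

end
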